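import Summits.QuantumFields.GaugeBoot.BootstrapWordTruncation
import HarnessLib

/-!
# Level-explicit bounds: the level-`n` positivity constraints bound every word of length `≤ 2n` (gauge-boot, L1 supplement)

HONEST FRAMING (cell `pub-gaugeboot`, page 1 of every file): the venture produces certified bounds
on lattice expectations at stated coupling, gauge group, dimension and torus size; NOT a mass gap,
NOT a continuum limit, NOT a string tension; NOT Yang–Mills-summit-bearing (barriers
`FixedCouplingUltralocality`, `PerturbativeInvisibility`). Structural; it certifies no number.

## Content

`BootstrapBounds.lean` proves that finitely many PSD constraints bound every word, in the form
"there is a finite set of squares". This file makes the LEVEL explicit, as needed for quantitative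
statements about the word-length truncation (`wordTruncation r n` = span of the words of length `≤ n`,
the level-`n` test functions):

* `sq_le_of_sq_nonneg` — if `0 ≤ φ (v v)` for every level-`n` test function `v`, then `φ (w w) ≤ φ 1`
  for every word `w` of length `≤ n` (induction over the word: `φ(x² y²) ≤ φ(x²) ≤ φ 1` with the
  functional `f ↦ φ(x² f)`, unit rows `Σ_b Re² + Im² = 1`);
* ★★ `abs_mul_le_one_of_sq_nonneg` — plus `φ 1 = 1`: `|φ (v w)| ≤ 1` for all words `v`, `w` of length
  `≤ n` (polarisation `0 ≤ φ((v ± w)²)`), hence ★★ `abs_le_one_of_sq_nonneg_two_mul`: `|φ w| ≤ 1` for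
  EVERY WORD OF LENGTH `≤ 2n` — the moment matrix of the level-`n` bootstrap has entries in `[-1, 1]`;
* `IsBootstrapFeasible.abs_word_le_one`, `abs_sub_word_le_two` — for level-`n` feasible functionals
  of the tree's truncated bootstrap and for differences of two of them;
* `exists_const_abs_le_of_mem_span` — a fixed element of a span is bounded by a constant times any
  uniform bound on the spanning set (the base case of the strong-coupling-order induction).

References: P. Anderson, M. Kruczenski, Nucl. Phys. B 921 (2017) §2 (unitarity bounds
`|W| ≤ 1`); V. Kazakov, Z. Zheng, arXiv:2203.11360 §2. Folklore.
-/

noncomputable section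

open Literature.MathematicalPhysics.QuantumFieldTheory (LatticeRep)

namespace Summit.QuantumFields.GaugeBoot

variable {ι : Type*} {G : Type*} [Group G] [TopologicalSpace G] (r : LatticeRep G)

/-! ## Words and the truncation -/

/-- Words of length `≤ n` are level-`n` test functions. -/
theorem mem_wordTruncation_of_mem_wordsUpTo {n : ℕ} {w : C(ι → G, ℝ)}
    (hw : w ∈ wordsUpTo (ι := ι) r n) : w ∈ wordTruncation (ι := ι) r n :=
  Submodule.subset_span hw

/-- A generator times a word of length `≤ n` is a word of length `≤ n + 1`. -/
theorem mul_mem_wordsUpTo_succ {x : C(ι → G, ℝ)} (hx : x ∈ entryGens (ι := ι) r) {n : ℕ}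
    {w : C(ι → G, ℝ)} (hw : w ∈ wordsUpTo (ι := ι) r n) : x * w ∈ wordsUpTo (ι := ι) r (n + 1) := by
  obtain ⟨l, hl, hlen, rfl⟩ := hw
  refine ⟨x :: l, fun y hy => ?_, by simpa using hlen, List.prod_cons⟩
  rcases List.mem_cons.1 hy with rfl | hy
  · exact hx
  · exact hl y hy

/-- A generator times a level-`n` test function is a level-`(n+1)` test function. -/
theorem mul_mem_wordTruncation_succ {x : C(ι → G, ℝ)} (hx : x ∈ entryGens (ι := ι) r) {n : ℕ}
    {v : C(ι → G, ℝ)} (hv : v ∈ wordTruncation (ι := ι) r n) :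
    x * v ∈ wordTruncation (ι := ι) r (n + 1) := by
  change v ∈ Submodule.span ℝ (wordsUpTo (ι := ι) r n) at hv
  induction hv using Submodule.span_induction with
  | mem w hw => exact mem_wordTruncation_of_mem_wordsUpTo r (mul_mem_wordsUpTo_succ r hx hw)
  | zero => rw [mul_zero]; exact Submodule.zero_mem _
  | add v w _ _ hv hw => rw [mul_add]; exact Submodule.add_mem _ hv hw
  | smul c v _ hv => rw [mul_smul_comm]; exact Submodule.smul_mem _ c hv

/-- Two words of length `≤ n` multiply to a word of length `≤ 2n`, and conversely every word of
length `≤ 2n` splits so. -/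
theorem exists_mul_of_mem_wordsUpTo_two_mul {n : ℕ} {w : C(ι → G, ℝ)}
    (hw : w ∈ wordsUpTo (ι := ι) r (2 * n)) :
    ∃ v ∈ wordsUpTo (ι := ι) r n, ∃ v' ∈ wordsUpTo (ι := ι) r n, w = v * v' := by
  obtain ⟨l, hl, hlen, rfl⟩ := hw
  refine ⟨(l.take n).prod, ⟨l.take n, fun x hx => hl x (List.mem_of_mem_take hx), ?_, rfl⟩,
    (l.drop n).prod, ⟨l.drop n, fun x hx => hl x (List.mem_of_mem_drop hx), ?_, rfl⟩, ?_⟩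
  · rw [List.length_take]
    exact min_le_left _ _
  · rw [List.length_drop]
    omega
  · rw [← List.prod_append, List.take_append_drop]

/-! ## Squares of words are dominated by `φ 1`, level by level -/

/-- The square of a generator is dominated by `φ 1` as soon as `φ` is non-negative on the squares of
the generators (unit rows of the unitary `ρ(U_e)`). -/
theorem sq_entryGen_le {x : C(ι → G, ℝ)} (hx : x ∈ entryGens (ι := ι) r) (φ : C(ι → G, ℝ) →ₗ[ℝ] ℝ)
    (hφ : ∀ g ∈ entryGens (ι := ι) r, 0 ≤ φ (g * g)) : φ (x * x) ≤ φ 1 := by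
  have key : ∀ (e : ι) (a b : Fin r.N),
      φ (reEntry r e a b * reEntry r e a b) ≤ φ 1 ∧ φ (imEntry r e a b * imEntry r e a b) ≤ φ 1 := by
    intro e a b
    have hre : ∀ b', 0 ≤ φ (reEntry r e a b' * reEntry r e a b') := fun b' =>
      hφ _ (Or.inl ⟨(e, a, b'), rfl⟩)
    have him : ∀ b', 0 ≤ φ (imEntry r e a b' * imEntry r e a b') := fun b' =>
      hφ _ (Or.inr ⟨(e, a, b'), rfl⟩)
    have hnn : ∀ b' ∈ (Finset.univ : Finset (Fin r.N)),
        0 ≤ φ (reEntry r e a b' * reEntry r e a b' + imEntry r e a b' * imEntry r e a b') :=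
      fun b' _ => by rw [map_add]; exact add_nonneg (hre b') (him b')
    have hsum := Finset.single_le_sum hnn (Finset.mem_univ b)
    rw [← map_sum, sum_sq_entries_eq_one r e a, map_add] at hsum
    exact ⟨le_trans (le_add_of_nonneg_right (him b)) hsum, le_trans (le_add_of_nonneg_left (hre b)) hsum⟩
  rcases hx with ⟨⟨e, a, b⟩, rfl⟩ | ⟨⟨e, a, b⟩, rfl⟩
  · exact (key e a b).1
  · exact (key e a b).2

/-- `φ (w w) ≤ φ 1` for a product `w` of at most `n` generators, from the level-`n` squares
(induction over the list of letters). -/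
theorem sq_prod_le_of_sq_nonneg (l : List C(ι → G, ℝ)) (hl : ∀ y ∈ l, y ∈ entryGens (ι := ι) r)
    {n : ℕ} (hlen : l.length ≤ n) (φ : C(ι → G, ℝ) →ₗ[ℝ] ℝ)
    (hφ : ∀ v ∈ wordTruncation (ι := ι) r n, 0 ≤ φ (v * v)) : φ (l.prod * l.prod) ≤ φ 1 := by
  induction l generalizing n φ with
  | nil => simp
  | cons x l ih =>
    have hx : x ∈ entryGens (ι := ι) r := hl x List.mem_cons_self
    have hl' : ∀ y ∈ l, y ∈ entryGens (ι := ι) r := fun y hy => hl y (List.mem_cons_of_mem x hy)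
    obtain ⟨m, rfl⟩ : ∃ m, n = m + 1 := ⟨n - 1, by simp at hlen; omega⟩
    have hlen' : l.length ≤ m := by simpa using hlen
    -- the functional `f ↦ φ (x x f)` is non-negative on the level-`m` squares
    set ψ : C(ι → G, ℝ) →ₗ[ℝ] ℝ := φ ∘ₗ LinearMap.mulLeft ℝ (x * x) with hψ
    have hψv : ∀ v ∈ wordTruncation (ι := ι) r m, 0 ≤ ψ (v * v) := fun v hv => by
      have h := hφ (x * v) (mul_mem_wordTruncation_succ r hx hv)
      have e1 : x * v * (x * v) = x * x * (v * v) := by ring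
      rw [e1] at h
      simpa only [hψ, LinearMap.coe_comp, Function.comp_apply, LinearMap.mulLeft_apply] using h
    have h1 : φ (x * x * (l.prod * l.prod)) ≤ φ (x * x) := by
      simpa only [hψ, LinearMap.coe_comp, Function.comp_apply, LinearMap.mulLeft_apply, mul_one]
        using ih hl' hlen' ψ hψv
    have h2 : φ (x * x) ≤ φ 1 := sq_entryGen_le r hx φ fun g hg =>
      hφ g (mem_wordTruncation_of_mem_wordsUpTo r ⟨[g], by simpa using hg, by simp, by simp⟩)
    have e2 : (x :: l).prod * (x :: l).prod = x * x * (l.prod * l.prod) := by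
      rw [List.prod_cons]; ring
    rw [e2]
    exact h1.trans h2

/-- ★ **`φ (w w) ≤ φ 1` for words of length `≤ n` from the level-`n` squares.** Every linear
functional non-negative on the squares of the level-`n` test functions satisfies `φ (w w) ≤ φ 1`
for every word `w` of length `≤ n`. [folklore] -/
theorem sq_le_of_sq_nonneg {n : ℕ} {w : C(ι → G, ℝ)} (hw : w ∈ wordsUpTo (ι := ι) r n)
    (φ : C(ι → G, ℝ) →ₗ[ℝ] ℝ) (hφ : ∀ v ∈ wordTruncation (ι := ι) r n, 0 ≤ φ (v * v)) :
    φ (w * w) ≤ φ 1 := by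
  obtain ⟨l, hl, hlen, rfl⟩ := hw
  exact sq_prod_le_of_sq_nonneg r l hl hlen φ hφ

/-- ★★ **`|φ (v w)| ≤ 1` for words `v`, `w` of length `≤ n`** from normalisation and the level-`n`
squares (polarisation: `0 ≤ φ((v ± w)²) = φ(v²) ± 2 φ(v w) + φ(w²) ≤ 2 ± 2 φ(v w)`). So EVERY ENTRY
of the level-`n` moment matrix lies in `[-1, 1]`. [folklore] -/
theorem abs_mul_le_one_of_sq_nonneg {n : ℕ} {v w : C(ι → G, ℝ)} (hv : v ∈ wordsUpTo (ι := ι) r n)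
    (hw : w ∈ wordsUpTo (ι := ι) r n) (φ : C(ι → G, ℝ) →ₗ[ℝ] ℝ) (h1 : φ 1 = 1)
    (hφ : ∀ u ∈ wordTruncation (ι := ι) r n, 0 ≤ φ (u * u)) : |φ (v * w)| ≤ 1 := by
  have hvv : φ (v * v) ≤ 1 := h1 ▸ sq_le_of_sq_nonneg r hv φ hφ
  have hww : φ (w * w) ≤ 1 := h1 ▸ sq_le_of_sq_nonneg r hw φ hφ
  have hvT := mem_wordTruncation_of_mem_wordsUpTo r hv
  have hwT := mem_wordTruncation_of_mem_wordsUpTo r hw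
  have hp : 0 ≤ φ ((v + w) * (v + w)) := hφ _ (Submodule.add_mem _ hvT hwT)
  have hm : 0 ≤ φ ((v - w) * (v - w)) := hφ _ (Submodule.sub_mem _ hvT hwT)
  have ep : (v + w) * (v + w) = v * v + 2 • (v * w) + w * w := by ring
  have em : (v - w) * (v - w) = v * v - 2 • (v * w) + w * w := by ring
  rw [ep, map_add, map_add, map_nsmul, nsmul_eq_mul] at hp
  rw [em, map_add, map_sub, map_nsmul, nsmul_eq_mul] at hm
  push_cast at hp hm
  rw [abs_le]
  constructor <;> linarith

/-- ★★ **Every word of length `≤ 2n` has `|φ w| ≤ 1`** under normalisation and the level-`n`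
squares. [folklore] -/
theorem abs_le_one_of_sq_nonneg_two_mul {n : ℕ} {w : C(ι → G, ℝ)}
    (hw : w ∈ wordsUpTo (ι := ι) r (2 * n)) (φ : C(ι → G, ℝ) →ₗ[ℝ] ℝ) (h1 : φ 1 = 1)
    (hφ : ∀ u ∈ wordTruncation (ι := ι) r n, 0 ≤ φ (u * u)) : |φ w| ≤ 1 := by
  obtain ⟨v, hv, v', hv', rfl⟩ := exists_mul_of_mem_wordsUpTo_two_mul r hw
  exact abs_mul_le_one_of_sq_nonneg r hv hv' φ h1 hφ

/-- In particular `|φ w| ≤ 1` for words of length `≤ n`. -/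
theorem abs_le_one_of_sq_nonneg {n : ℕ} {w : C(ι → G, ℝ)} (hw : w ∈ wordsUpTo (ι := ι) r n)
    (φ : C(ι → G, ℝ) →ₗ[ℝ] ℝ) (h1 : φ 1 = 1)
    (hφ : ∀ u ∈ wordTruncation (ι := ι) r n, 0 ≤ φ (u * u)) : |φ w| ≤ 1 :=
  abs_le_one_of_sq_nonneg_two_mul r (wordsUpTo_mono r (by omega) hw) φ h1 hφ

/-! ## Feasible functionals of the word-length truncation -/

section Feasible

variable [DecidableEq ι] {K : Type*} {k : K → ℝ → G} {S : ι → (ι → G) → ℝ} {β : ℝ}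

/-- ★★ **A level-`n` feasible functional has all words of length `≤ 2n` in `[-1, 1]`.** [folklore] -/
theorem IsBootstrapFeasible.abs_word_le_one {n : ℕ} {φ : C(ι → G, ℝ) →ₗ[ℝ] ℝ}
    (hφ : IsBootstrapFeasible r k S β (wordTruncation (ι := ι) r n) φ) {w : C(ι → G, ℝ)}
    (hw : w ∈ wordsUpTo (ι := ι) r (2 * n)) : |φ w| ≤ 1 :=
  abs_le_one_of_sq_nonneg_two_mul r hw φ hφ.1 hφ.2.1

/-- **Two level-`n` feasible functionals differ by at most `2` on every word of length `≤ 2n`.** -/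
theorem abs_sub_word_le_two {n : ℕ} {φ ψ : C(ι → G, ℝ) →ₗ[ℝ] ℝ}
    (hφ : IsBootstrapFeasible r k S β (wordTruncation (ι := ι) r n) φ)
    (hψ : IsBootstrapFeasible r k S β (wordTruncation (ι := ι) r n) ψ) {w : C(ι → G, ℝ)}
    (hw : w ∈ wordsUpTo (ι := ι) r (2 * n)) : |(φ - ψ) w| ≤ 2 := by
  rw [LinearMap.sub_apply]
  calc |φ w - ψ w| ≤ |φ w| + |ψ w| := abs_sub _ _
    _ ≤ 1 + 1 := add_le_add (hφ.abs_word_le_one r hw) (hψ.abs_word_le_one r hw)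
    _ = 2 := by norm_num

end Feasible

/-! ## Elements of a span are bounded by the spanning set -/

omit [Group G] in
/-- ★ **A fixed element of a span is bounded by a constant times any uniform bound on the spanning
set**: for `h ∈ span s` there is `C ≥ 0` with `|δ h| ≤ C B` for every linear `δ` and every `B` such
that `|δ w| ≤ B` on `s` (write `h = Σ c_j w_j`; `C = Σ |c_j|`). [folklore] -/
theorem exists_const_abs_le_of_mem_span {s : Set C(ι → G, ℝ)} {h : C(ι → G, ℝ)}
    (hh : h ∈ Submodule.span ℝ s) :
    ∃ C : ℝ, 0 ≤ C ∧ ∀ (δ : C(ι → G, ℝ) →ₗ[ℝ] ℝ) (B : ℝ), (∀ w ∈ s, |δ w| ≤ B) → |δ h| ≤ C * B := by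
  classical
  obtain ⟨n, c, g, hsum⟩ := Submodule.mem_span_set'.1 hh
  refine ⟨∑ j, |c j|, Finset.sum_nonneg fun j _ => abs_nonneg _, fun δ B hB => ?_⟩
  rw [← hsum, map_sum, Finset.sum_mul]
  simp only [map_smul, smul_eq_mul]
  refine (Finset.abs_sum_le_sum_abs _ _).trans (Finset.sum_le_sum fun j _ => ?_)
  rw [abs_mul]
  exact mul_le_mul_of_nonneg_left (hB _ (g j).2) (abs_nonneg _)

end Summit.QuantumFields.GaugeBoot

end
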